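import Summits.HodgeConjecture.HodgeConjecture.Theorems.H413CuspCotTransport
import HarnessLib

/-!
# FLOOR-0 P4, seat S4′ (R4) — the CONVERSE transport: a saturated cuspidal cotangent form of an OPEN level on the regime model,
# read back along `e : U(V)(𝔸_{F⁺}) ≃* G_U(𝔸)`, IS a holomorphic cotangent form for the factor of record `archFactorOf F V`

Cell hodgecm-mathlib (D-0151), FLOOR 0, crux item H413 = stmt-HodgeConjecture-24833; programme P4, line
`Cruxes/H413/Lines/F0_P4AdmissibleOccursInH1.lean` (ed. 1 98373f7d ∕ ed. 1.1 e5b40b47), seat S4′ `stub_T3a_holThetaRealisationOfRallisAt`,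
step (R4) of F0P4-plan's `DECISIONS-T3a.v1` (f270b9e0) D2 «CONVERSE BRIDGE … FIRST GREEN-ABLE LEAF»; read-in A-p17 (g12) `T3a-READIN` 350e0696.
`--supports stmt-HodgeConjecture-24833 --as helper`.  THEOREMS ONLY (no definition: the inverse transport `g ↦ g ∘ e` is written with Mathlib's
`LinearMap.funLeft ℂ (Fin 2 → ℂ) e`, the inverse of A-p13's ★ `toRegimeFun = LinearMap.funLeft ℂ _ e.symm`); no named fact, no instance, no `sorry`.

A-p13 (g21)'s ★ `Theorems/H413CuspCotTransport.lean` proves the FORWARD transport `toRegimeFun_mem_cuspCotSat`: `f ∈ holCotForms (archFactorOf F V)`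
fixed by `K` ⟹ `f ∘ e⁻¹ ∈ cuspCotSat V hV K`.  The theta road of S4′ produces forms ON THE REGIME MODEL (the HodgeCM model's theta
distributions `ThetaDistDatum.dist`, weight-`τ₁` hol-germ saturated forms on `G_U(𝔸) = (V.latticeModel _).G`); to land them in the P0 carrier
`holCotForms (archFactorOf F V)` of the stub one needs the CONVERSE, proved here:

* the inverse transport `LinearMap.funLeft ℂ (Fin 2 → ℂ) e : (G_U(𝔸) → ℂ²) →ₗ[ℂ] (U(V)(𝔸_{F⁺}) → ℂ²)`, `g ↦ g ∘ e`: the two round trips with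
  `toRegimeFun` (`toRegimeFun_funLeft_latticeEquiv`, `funLeft_latticeEquiv_toRegimeFun`), injectivity, and `funLeft_latticeEquiv_rightShift`
  (it intertwines `rightShift (finToG V hV k)` with `rightRep F V k`);
* `latticeEquiv_toAdelic_mem_Γ` — `e` carries the rational points `U(V)(F⁺)` INTO the arithmetic subgroup `Γ` of the regime model (converse of
  ★ `latticeEquiv_symm_mem_range_toAdelic`);
* `latticeEquiv_mem_satLevelRegimeOf_of_mem_Kc`, `finToG_mem_satLevelRegimeOf` — `e(K_c)` and `e(1 × K)` lie in the saturation subgroup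
  `sat(K)` (converse of ★ `exists_of_mem_satLevelRegimeOf`);
* **`funLeft_latticeEquiv_mem_holCotForms`** — for `g ∈ cuspCotSat V hV K` with `K` OPEN: `g ∘ e ∈ holCotForms (archFactorOf F V)` ((L) from the
  rational points, (W) along `e ∘ ιinf = archInfOf V`, (K_c) and smoothness from `sat(K) ⊇ e(K_c) ∪ e(1 × K)` — smoothness is where
  openness of `K` is used —, (H) germs correspond); and the packaging `cuspCotSat_le_map_toRegimeFun`:
  `cuspCotSat V hV K ≤ (holCotForms (archFactorOf F V)).map (toRegimeFun F V hV)`.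

HC_CM is proved only modulo the 7 printed citations until rung 0 closes; this file proves nothing about them.
[cite: BorelJacquet1979, §4.1–§4.2] [cite: BorelWallach2000, XIII 1.2] [cite: Borel1997, §5.14]

## References
* [BorelJacquet1979] A. Borel, H. Jacquet, *Automorphic forms and automorphic representations*, Corvallis PSPM 33.1, §4.1–§4.2.
* [BorelWallach2000] A. Borel, N. Wallach, Math. Surveys Monogr. 67, XIII 1.2.  * [Borel1997] A. Borel, *Automorphic forms on SL₂(ℝ)*, §5.14.
* Tree: ★ `Theorems/H413CuspCotTransport` (A-p13 (g21): `latticeEquiv`, `toRegimeFun`, `toRegimeFun_mem_cuspCotSat`), ★ `Theorems/H413CuspCotComponents`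
  (`cuspCotSat`), ★ `Theorems/H413CohFormsCarriers` (P0: `holCotForms`, `archFactorOf`, `archFactorOf_Kc`), HodgeCM `Model/Junction/LevelSaturation`.
-/

set_option autoImplicit false
set_option linter.dupNamespace false

noncomputable section

open MulAction NumberField
open Literature.NumberTheory.Automorphic Literature.NumberTheory.Automorphic.UnitaryGroup
open Literature.Geometry.ComplexHyperbolic.BallModel (U21 x₀)
open Literature.AlgebraicGeometry.ShimuraVarieties
open HodgeCM HodgeCM.Model HodgeCM.Model.ThetaSpace
open Summit.HodgeConjecture.HodgeConjecture.Cruxes.H413.CohFormsCarriers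

namespace Summit.HodgeConjecture.HodgeConjecture.Cruxes.H413.CuspCot

variable (F : HodgeCM.CMField) {ι₁ : F →+* ℂ} (V : HodgeCM.HermSpace3 F ι₁) (hV : IsAnisotropic F (HodgeCM.HermSpace3.Hm V))

/-! ## §1 The inverse transport `g ↦ g ∘ e` (Mathlib `LinearMap.funLeft ℂ (Fin 2 → ℂ) e`; no new definition) -/

/-- Unfolding the inverse transport: `(funLeft e g) x = g (e x)`. [cite: BorelJacquet1979, §4.2] -/
theorem funLeft_latticeEquiv_apply (g : (V.latticeModel printFact_unitaryCompact_holds).G → (Fin 2 → ℂ)) (x : (adelicDatum F V).Adelic) :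
    LinearMap.funLeft ℂ (Fin 2 → ℂ) (latticeEquiv F V hV) g x = g (latticeEquiv F V hV x) := rfl

/-- `toRegimeFun ∘ (funLeft e) = id`. [cite: BorelJacquet1979, §4.2] -/
@[simp] theorem toRegimeFun_funLeft_latticeEquiv (g : (V.latticeModel printFact_unitaryCompact_holds).G → (Fin 2 → ℂ)) :
    toRegimeFun F V hV (LinearMap.funLeft ℂ (Fin 2 → ℂ) (latticeEquiv F V hV) g) = g := by
  funext y
  rw [toRegimeFun_apply, funLeft_latticeEquiv_apply, MulEquiv.apply_symm_apply]

/-- `(funLeft e) ∘ toRegimeFun = id`. [cite: BorelJacquet1979, §4.2] -/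
@[simp] theorem funLeft_latticeEquiv_toRegimeFun (f : (adelicDatum F V).Adelic → (Fin 2 → ℂ)) :
    LinearMap.funLeft ℂ (Fin 2 → ℂ) (latticeEquiv F V hV) (toRegimeFun F V hV f) = f := by
  funext x
  rw [funLeft_latticeEquiv_apply, toRegimeFun_apply, MulEquiv.symm_apply_apply]

/-- The inverse transport is injective (`e` is a bijection). [cite: BorelJacquet1979, §4.2] -/
theorem funLeft_latticeEquiv_injective : Function.Injective (LinearMap.funLeft ℂ (Fin 2 → ℂ) (latticeEquiv F V hV)) :=
  LinearMap.funLeft_injective_of_surjective _ _ _ (latticeEquiv F V hV).surjective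

/-- **The inverse transport intertwines the finite-adelic right translations**: `(R_{e_k} g) ∘ e = R_k (g ∘ e)`. [cite: BorelJacquet1979, §4.2] -/
theorem funLeft_latticeEquiv_rightShift (k : ↥(HodgeCM.HermSpace3.adelicFin V)) (g : (V.latticeModel printFact_unitaryCompact_holds).G → (Fin 2 → ℂ)) :
    LinearMap.funLeft ℂ (Fin 2 → ℂ) (latticeEquiv F V hV) (rightShift (finToG V hV k) g) =
      rightRep F V k (LinearMap.funLeft ℂ (Fin 2 → ℂ) (latticeEquiv F V hV) g) := by
  funext x
  rw [funLeft_latticeEquiv_apply, rightShift_apply, ← latticeEquiv_finToAdelic, ← map_mul]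
  rfl

/-! ## §2 `e` carries rational points into `Γ` and `K_c`, `1 × K` into the saturation subgroup `sat(K)` -/

/-- **Rational points go to `Γ`**: for `γ ∈ U(V)(F⁺)`, `e(γ)` lies in the arithmetic subgroup of the regime model (converse of ★
`latticeEquiv_symm_mem_range_toAdelic`). [cite: BorelJacquet1979, §4.1] -/
theorem latticeEquiv_mem_Γ_of_mem_range {x : (adelicDatum F V).Adelic} (hx : x ∈ (adelicDatum F V).toAdelic.range) :
    latticeEquiv F V hV x ∈ (V.latticeModel printFact_unitaryCompact_holds).Γ := by
  obtain ⟨g, rfl⟩ := hx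
  refine (HodgeCM.Adelic.mem_regimeRat_iff (L := F) (H := HodgeCM.HermSpace3.Hm V) _).2 ?_
  -- `e = regimeEquiv ∘ twin` (by `rfl`) and `↑(regimeEquiv y) = y`
  have hcoe := HodgeCM.Adelic.coe_regimeEquiv F (HodgeCM.HermSpace3.Hm V) hV
    (HodgeCM.Model.Junction.adelicUnitaryGroupTwin (HodgeCM.CMField.K F) (HodgeCM.HermSpace3.Hm V) ((adelicDatum F V).toAdelic g))
  change ((HodgeCM.Adelic.regimeEquiv F (HodgeCM.HermSpace3.Hm V) hV
      (HodgeCM.Model.Junction.adelicUnitaryGroupTwin (HodgeCM.CMField.K F) (HodgeCM.HermSpace3.Hm V) ((adelicDatum F V).toAdelic g)) :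
        ↥(HodgeCM.Adelic.regimeSubgroup F (HodgeCM.HermSpace3.Hm V))) :
      ↥(HodgeCM.Adelic.adelicUnitaryGroup (HodgeCM.CMField.K F) (HodgeCM.HermSpace3.Hm V))) ∈ _
  rw [hcoe]
  refine (HodgeCM.Model.Junction.adelicUnitaryGroupTwin_mem_rat_iff (HodgeCM.CMField.K F) (HodgeCM.HermSpace3.Hm V) _).2 ?_
  exact (Literature.NumberTheory.Automorphic.mem_adelicUnitaryRat_iff (HodgeCM.CMField.K F) (HodgeCM.HermSpace3.Hm V) _).2
    ⟨g.1, g.2, rfl⟩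

/-- **`e(1 × k) ∈ sat(K)` for `k ∈ K`**: the finite-adelic factor is away from `ι₁` and its finite part is `k`. [cite: BorelJacquet1979, §4.1] -/
theorem finToG_mem_satLevelRegimeOf {K : Subgroup ↥(HodgeCM.HermSpace3.adelicFin V)} {k : ↥(HodgeCM.HermSpace3.adelicFin V)} (hk : k ∈ K) :
    finToG V hV k ∈ satLevelRegimeOf V hV K := by
  rw [← latticeEquiv_finToAdelic]
  refine HodgeCM.Model.mem_satLevelRegimeOf_of_mem V hV K ((HodgeCM.Model.mem_satLevelOf_iff V K _).2 ⟨?_, ?_⟩)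
  · exact finAdelicToAdelic_mem_awayFrom _ _ _ 3 _ _ _ _ k
  · refine (mem_cmSplitLevel_iff _ _ _ _ _).2 ?_
    show finPart _ _ _ 3 _ (finAdelicToAdelic _ _ _ 3 _ k) ∈ K
    rw [finPart_finAdelicToAdelic]
    exact hk

/-- **`e(b) ∈ sat(K)` for `b ∈ K_c`** (archimedean with trivial `ι₁`-component; its finite part is `1 ∈ K`). [cite: BorelJacquet1979, §4.1] -/
theorem latticeEquiv_mem_satLevelRegimeOf_of_mem_Kc (K : Subgroup ↥(HodgeCM.HermSpace3.adelicFin V)) {b : (adelicDatum F V).Adelic}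
    (hb : b ∈ (archFactorOf F V).Kc) : latticeEquiv F V hV b ∈ satLevelRegimeOf V hV K := by
  rw [archFactorOf_Kc] at hb
  obtain ⟨a, ha, rfl⟩ := Subgroup.mem_map.1 hb
  refine HodgeCM.Model.mem_satLevelRegimeOf_of_mem V hV K ((HodgeCM.Model.mem_satLevelOf_iff V K _).2 ⟨?_, ?_⟩)
  · -- away from `ι₁`: the `ι₁`-component of `a` is trivial
    have ha' : a ∈ (archAt (↥(maximalRealSubfield (HodgeCM.CMField.K F))) (HodgeCM.CMField.K F) (IsCMField.complexConj (HodgeCM.CMField.K F)) 3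
        (HodgeCM.HermSpace3.Hm V) (cmPlace (HodgeCM.CMField.K F) ι₁) (UnitaryGroup.complexConj_smul_infinitePlace (HodgeCM.CMField.K F) _)
        (IsCMField.complexConj_ne_one (HodgeCM.CMField.K F))).ker := by
      rw [← ker_archProjU21Emb _ _ _ (HodgeCM.HermSpace3.Hm V) ι₁ (isComplex_mk_of_isCMField (HodgeCM.CMField.K F) ι₁) V.sylvesterFrame
        (formCongr_eq_of_conjTranspose (HodgeCM.CMField.K F) ι₁ (HodgeCM.HermSpace3.Hm V) V.sylvesterFrame (HodgeCM.Model.sylvesterFrame_J V))]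
      exact ha
    refine (mem_awayFrom_iff _ _ _ 3 _ _ _ _ _).2 ?_
    show archAt _ _ _ 3 _ _ _ _ (archPart _ _ _ 3 _ (archToAdelic _ _ _ 3 _ a)) = 1
    rw [archPart_archToAdelic]
    exact MonoidHom.mem_ker.1 ha'
  · refine (mem_cmSplitLevel_iff _ _ _ _ _).2 ?_
    show finPart _ _ _ 3 _ (archToAdelic _ _ _ 3 _ a) ∈ K
    rw [finPart_archToAdelic]
    exact K.one_mem

/-! ## §3 The converse transport -/

variable {F V hV}

/-- **CONVERSE TRANSPORT**: a saturated cuspidal cotangent form `g` of an OPEN level `K` on the regime model, read on `U(V)(𝔸_{F⁺})` as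
`g ∘ e`, is a holomorphic cotangent form for the factor of record: (L) left `U(V)(F⁺)`-invariant (rational points go to `Γ`), (W) of right
`K_∞`-type `weightOf x₀` along `(archFactorOf F V).ιinf` (`e ∘ ιinf = archInfOf V`), (K_c) right `K_c`-invariant and SMOOTH (fixed by the
open `K`) since `e(K_c), e(1 × K) ⊆ sat(K)`, (H) with holomorphic germs along `ιinf`. [cite: BorelJacquet1979, §4.1–§4.2] [cite: Borel1997, §5.14]
[cite: BorelWallach2000, XIII 1.2] -/
theorem funLeft_latticeEquiv_mem_holCotForms {K : Subgroup ↥(HodgeCM.HermSpace3.adelicFin V)}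
    (hKo : IsOpen (K : Set ↥(HodgeCM.HermSpace3.adelicFin V)))
    {g : (V.latticeModel printFact_unitaryCompact_holds).G → (Fin 2 → ℂ)} (hg : g ∈ cuspCotSat V hV K) :
    LinearMap.funLeft ℂ (Fin 2 → ℂ) (latticeEquiv F V hV) g ∈ holCotForms (archFactorOf F V) := by
  refine ⟨⟨⟨⟨fun γ hγ x => ?_, fun u x => ?_⟩, fun b hb x => ?_⟩, ?_⟩, ?_⟩
  · -- (L)
    rw [funLeft_latticeEquiv_apply, funLeft_latticeEquiv_apply, map_mul]
    exact cuspCotSat.left_inv hg (latticeEquiv_mem_Γ_of_mem_range F V hV hγ) _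
  · -- (W)
    show g (latticeEquiv F V hV (x * (archFactorOf F V).ιinf u)) = _
    rw [map_mul, latticeEquiv_ιinf]
    exact cuspCotSat.apply_mul_archInfOf hg u _
  · -- (K_c)
    show g (latticeEquiv F V hV (x * b)) = g (latticeEquiv F V hV x)
    rw [map_mul]
    exact cuspCotSat.apply_mul_of_mem_sat hg (latticeEquiv_mem_satLevelRegimeOf_of_mem_Kc F V hV K hb) _
  · -- smooth: fixed by the open `K`
    refine Submodule.mem_iSup_of_mem K (Submodule.mem_iSup_of_mem hKo ?_)
    refine (Representation.mem_invariants _ _).2 fun k => ?_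
    funext x
    show g (latticeEquiv F V hV (x * finToAdelic F V (k : ↥(HodgeCM.HermSpace3.adelicFin V)))) = g (latticeEquiv F V hV x)
    rw [map_mul, latticeEquiv_finToAdelic]
    exact cuspCotSat.apply_mul_of_mem_sat hg (finToG_mem_satLevelRegimeOf F V hV k.2) _
  · -- (H) holomorphic germs
    have e : ∀ x, germAt (archFactorOf F V).ιinf (LinearMap.funLeft ℂ (Fin 2 → ℂ) (latticeEquiv F V hV) g) x =
        germAt (archInfOf V) g (latticeEquiv F V hV x) := by
      intro x; funext b
      rw [germAt_apply, germAt_apply, funLeft_latticeEquiv_apply, map_mul, latticeEquiv_ιinf]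
    exact ⟨fun x => by rw [e]; exact (cuspCotSat.isHolGerm hg).1 _, fun x v => by rw [e]; exact (cuspCotSat.isHolGerm hg).2 _ v⟩

/-- **Packaging**: at an OPEN level, every saturated cuspidal cotangent form on the regime model is `toRegimeFun` of a holomorphic cotangent form
for the factor of record — `cuspCotSat V hV K ≤ (holCotForms (archFactorOf F V)).map (toRegimeFun F V hV)`. [cite: BorelJacquet1979, §4.2] -/
theorem cuspCotSat_le_map_toRegimeFun {K : Subgroup ↥(HodgeCM.HermSpace3.adelicFin V)}
    (hKo : IsOpen (K : Set ↥(HodgeCM.HermSpace3.adelicFin V))) :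
    cuspCotSat V hV K ≤ (holCotForms (archFactorOf F V)).map (toRegimeFun F V hV) := fun g hg =>
  ⟨LinearMap.funLeft ℂ (Fin 2 → ℂ) (latticeEquiv F V hV) g, funLeft_latticeEquiv_mem_holCotForms hKo hg,
    toRegimeFun_funLeft_latticeEquiv F V hV g⟩

/-- … and the form read back is fixed by `K` under `rightRep` (so A-p13's forward transport applies to it at the same level).
[cite: BorelJacquet1979, §4.2] -/
theorem rightRep_funLeft_latticeEquiv_of_mem {K : Subgroup ↥(HodgeCM.HermSpace3.adelicFin V)}
    {g : (V.latticeModel printFact_unitaryCompact_holds).G → (Fin 2 → ℂ)} (hg : g ∈ cuspCotSat V hV K)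
    {k : ↥(HodgeCM.HermSpace3.adelicFin V)} (hk : k ∈ K) :
    rightRep F V k (LinearMap.funLeft ℂ (Fin 2 → ℂ) (latticeEquiv F V hV) g) =
      LinearMap.funLeft ℂ (Fin 2 → ℂ) (latticeEquiv F V hV) g := by
  funext x
  show g (latticeEquiv F V hV (x * finToAdelic F V k)) = g (latticeEquiv F V hV x)
  rw [map_mul, latticeEquiv_finToAdelic]
  exact cuspCotSat.apply_mul_of_mem_sat hg (finToG_mem_satLevelRegimeOf F V hV hk) _

end Summit.HodgeConjecture.HodgeConjecture.Cruxes.H413.CuspCot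

end
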